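import Summits.QuantumFields.YangMills.Theorems.BalabanUVNodesN21ExponentialChartResponse

/-!
# N21 (NE7c) · THE PLAQUETTE-READING STEP OF THE EXPONENTIAL BLOCK CHART: the field-strength letter `c_B` of the
# response road is a formula, and p592163's `responseLetters_of_blockExpChart` is knit at the OPEN REGULAR SET of
# configurations (W-SEAT START-LIST v8 §n21; g0's ASK l.26275 candidate (i) = RESPONSE-ROAD-N21W3.md §5(a))

Width seat `pub-ymgap-dag-n21-w3` (g2), node N21 = NE7c (NOT PRINTED in [Bałaban 1983–89], NOT proved), lane K3⁷
`SpineGivenEndpointR13SepCoPH` (stmt-QuantumFields-20544, `--kind proof --supports … --as helper`).  File 7 of this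
seat's response road; consumes BY NAME file 5 `…N21ExponentialChartResponse` (p592163: `norm_blockExponent_le`,
`blockExpChart_lipschitz`, ★★ `responseLetters_of_blockExpChart`), `Literature.Analysis.Complex.RungeUnits`
(`norm_exp_le_exp_norm`), Mathlib (`Units.ofNearby`, `NormedSpace.isUnit_exp`, `Ring.inverse_exp`,
`differentiableAt_inverse`, `Units.isOpen`).

WHY.  File 5 made the chart letter `ℓ` of file 4's §0 (`…N21ResponseRungNumeralAtThm1Letters`, p590159) a formula — in
the SUP NORM OVER BONDS of the configuration `χ(w) = (b ↦ exp(Σ_a w_a·X_a(b))·V₀(b))`.  File 4's located reading (L2)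
is at PLAQUETTE level: on the complex `r`-ball about the real cut point the perturbed data must be `(δ + c_B r)`-REGULAR,
i.e. their FIELD STRENGTH `‖∂V(p) − 1‖` — plaquette variables `∂V(p) = V(b₁)V(b₂)V(b₃)⁻¹V(b₄)⁻¹`, [B9] = CMP 99
(1985) 389, (3.1) p. 390 with the orientation convention (3.5) p. 391 «`U(x, x′) = U⁻¹(x′, x)`»; [B11] = CMP 102
(1985) 277, Theorem 1 p. 279: the data enter through «`|∂V − 1| < ε₁`», (7) — stays below Theorem 1's threshold, and
the domain on which the minimiser is analytic ([RG1] = [B12] = CMP 109 (1987) 249, Lemma 4 p. 280 ∕ the complex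
regular spaces (1.11)–(1.14) p. 262, tree `B12RegularSpaces111.space`) is cut out by the SAME plaquette variables of
`Gᶜ`-valued (invertible, not unitary) bond variables.  THIS FILE supplies the conversion — the bond-sup ball of radius
`R` about `χ(x)` lies in the REGULAR SET «every bond variable a unit and `‖∂V(p) − 1‖ ≤ δ + c·R` on the block's
plaquettes», `c` EXPLICIT in the chart data — and knits file 5's ★★ at `D :=` the open regular set: on the response
road every chart-side letter (`ℓ`, `c_B`, the domain inclusion) is now a formula, and the ONE located input left is
NODE O's — the plaquette reading `Ψ` of the minimiser differentiable with a sup bound on that regular set.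

WHAT IS PROVED ([textbook]; 0 def, 0 sorry; `𝔄` any complete normed `ℂ`-algebra with `‖1‖ = 1`; bonds `B` and block
coordinates `κ` finite types; a plaquette is an oriented boundary list `p : B × B × B × B` (first two bonds forward,
last two backward), its variable the explicit term `V p.1 * V p.2.1 * Ring.inverse (V p.2.2.1) * Ring.inverse
(V p.2.2.2)` — `Ring.inverse` the honest inverse on units, `0` elsewhere; no definition introduced).
* §1 `inverse_letters_of_norm_sub_le_half`: NEUMANN ABOUT A GENERAL UNIT `u`: `‖y − u‖·‖u⁻¹‖ ≤ ½` ⇒ `y` a unit,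
  `‖y⁻¹‖ ≤ 2‖u⁻¹‖`, `‖y⁻¹ − u⁻¹‖ ≤ 2‖u⁻¹‖²·‖y − u‖.
* §2 `norm_mul_four_le`, `norm_mul_four_sub_mul_four_le` (`‖Πa − Πb‖ ≤ m³·ΣL_i`); `bond_letters_of_near_units`;
  ★ `plaqReading_sub_le_of_units`: about a configuration `V` of units (`‖V(b)‖ ≤ n`, `‖V(b)⁻¹‖ ≤ n′`), every `V′`
  with `‖V′ − V‖ ≤ η`, `η·n′ ≤ ½` has unit bond variables and `‖∂V′(p) − ∂V(p)‖ ≤ max(n + η, 2n′)³·(2 + 4n′²)·η` —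
  the `Gᶜ`-valued twin of the UNITARY tree lemma `B9Ineq369CurvatureTwoBackgrounds.norm_plaqHolU_sub_le` (constant 4).
* §3 `isUnit_exp_complex`, `inverse_exp_complex`, `isUnit_blockExpChart_apply`, `inverse_blockExpChart_apply`
  (`(exp(A)V₀)⁻¹ = V₀⁻¹exp(−A)`), `norm_blockExpChart_apply_le` (`≤ e^{‖x‖Ξ}v`), `norm_inverse_blockExpChart_apply_le`
  (`≤ v′e^{‖x‖Ξ}`).
* §4 ★ `fieldStrength_closedBall_blockExpChart`: THE LETTER `c_B` — `‖∂χ(x)(p) − 1‖ ≤ δ` on `plaqs` and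
  `R·v′e^{‖x‖Ξ} ≤ ½` ⇒ every `V ∈ closedBall (χ x) R` has unit bond variables and `‖∂V(p) − 1‖ ≤ δ + c·R` on
  `plaqs`, `c = max(e^{‖x‖Ξ}v + R, 2v′e^{‖x‖Ξ})³·(2 + 4(v′e^{‖x‖Ξ})²)`.
* §5 `isOpen_unitConfigs`, `differentiableOn_plaqReading`, `isOpen_regularConfigs`: the regular set
  `{V | (∀ b, IsUnit (V b)) ∧ ∀ p ∈ plaqs, ‖∂V(p) − 1‖ < ε}` is OPEN, plaquette variables are complex differentiable
  on unit configurations («`Ψ` differentiable on the regular set» is an honest analyticity clause).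
* §6 ★★ `responseLetters_of_blockExpChart_regular`: `Ψ` differentiable on the regular set of radius `ε` with
  `‖Ψ‖ ≤ S`, base field strength `≤ δ`, `ℓ = Ξe^{(‖x‖+r)Ξ}v`, `ℓr·v′e^{‖x‖Ξ} ≤ ½`, budget `δ + c·ℓr < ε` ⇒ file 2's
  letters `hd`, `hB` (`B = 2S`) for `Φ = Ψ ∘ χ` on `ball x r` — file 5's ★★ with `hD` DISCHARGED.
* §7 A2∕A6 `fieldStrength_letters_inhabited` (`𝔄 = ℂ`, one bond, one coordinate): §4's hypotheses are jointly
  inhabited and its conclusion is read at a configuration `V ≠ χ(x)` of the ball.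

HONEST FRAMING.  [textbook] Banach-algebra bookkeeping; the identifications (`δ ↔ ε₁` data regularity, `ε ↔` the
threshold `a₁` of Theorem 1 ∕ the radius of the complex regular space, `S ↔ B₃εσ`, `χ ↔` print's charts
(1.12)–(1.13) ∕ (2.21)) are a located DICTIONARY, NOT asserted and NOT typed at NODE 00's objects
(`Node00.UbgOfRecord`); nothing of Bałaban's asserted; NE7c NOT PRINTED ∕ NOT proved; N21 NOT discharged; counts
unmoved (typed 28∕28 · discharged 5∕27); count-neutral; one finite 𝕋⁴ at fixed ε — YM mass gap (Clay) is NOT proved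
by any of this: R4 closes the conditional finite-𝕋⁴ rung `BalabanLadder.UV` only; nothing continuum ∕ ℝ⁴ ∕ OS ∕
mass gap ∕ Clay.
-/

noncomputable section

open NormedSpace Metric Set

namespace Summit.QuantumFields.YangMills.Theorems.N21ExponentialChartFieldStrength

open Summit.QuantumFields.YangMills.Theorems.N21ExponentialChartResponse
  (norm_blockExponent_le blockExpChart_lipschitz responseLetters_of_blockExpChart)

variable {𝔄 : Type*} [NormedRing 𝔄] [NormedAlgebra ℂ 𝔄] [CompleteSpace 𝔄] [NormOneClass 𝔄]

/-! ## §1  Neumann about a general unit -/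

omit [NormedAlgebra ℂ 𝔄] in
/-- **NEUMANN ABOUT A GENERAL UNIT.**  If `‖y − u‖·‖u⁻¹‖ ≤ ½` for a unit `u`, then `y` is a unit,
`‖y⁻¹‖ ≤ 2‖u⁻¹‖` and `‖y⁻¹ − u⁻¹‖ ≤ 2‖u⁻¹‖²·‖y − u‖` (`y⁻¹ − u⁻¹ = y⁻¹(u − y)u⁻¹`; the inverse written
`Ring.inverse`). [textbook] -/
theorem inverse_letters_of_norm_sub_le_half (u : 𝔄ˣ) {y : 𝔄} (h : ‖y - ↑u‖ * ‖(↑u⁻¹ : 𝔄)‖ ≤ 1 / 2) :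
    IsUnit y ∧ ‖Ring.inverse y‖ ≤ 2 * ‖(↑u⁻¹ : 𝔄)‖ ∧
      ‖Ring.inverse y - ↑u⁻¹‖ ≤ 2 * ‖(↑u⁻¹ : 𝔄)‖ ^ 2 * ‖y - ↑u‖ := by
  haveI : Nontrivial 𝔄 := NormOneClass.nontrivial
  have hpos : 0 < ‖(↑u⁻¹ : 𝔄)‖ := Units.norm_pos u⁻¹
  have hlt : ‖y - ↑u‖ < ‖(↑u⁻¹ : 𝔄)‖⁻¹ := by
    rw [inv_eq_one_div, lt_div_iff₀ hpos]; linarith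
  set w : 𝔄ˣ := u.ofNearby y hlt
  have hw : (w : 𝔄) = y := Units.val_ofNearby u y hlt
  have hunit : IsUnit y := hw ▸ w.isUnit
  have hinv : Ring.inverse y = ↑w⁻¹ := by rw [← hw, Ring.inverse_unit]
  have key : (↑w⁻¹ : 𝔄) - ↑u⁻¹ = ↑w⁻¹ * ((u : 𝔄) - ↑w) * ↑u⁻¹ := by
    rw [mul_sub, sub_mul, Units.mul_inv_cancel_right, Units.inv_mul, one_mul]
  have hyu : ‖(u : 𝔄) - ↑w‖ = ‖y - ↑u‖ := by rw [hw, norm_sub_rev]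
  have hprod : ‖(↑w⁻¹ : 𝔄) * ((u : 𝔄) - ↑w) * ↑u⁻¹‖ ≤ ‖(↑w⁻¹ : 𝔄)‖ * ‖y - ↑u‖ * ‖(↑u⁻¹ : 𝔄)‖ :=
    hyu ▸ norm_mul₃_le
  have hW : ‖(↑w⁻¹ : 𝔄)‖ ≤ 2 * ‖(↑u⁻¹ : 𝔄)‖ := by
    have h1 : ‖(↑w⁻¹ : 𝔄)‖ ≤ ‖(↑u⁻¹ : 𝔄)‖ + ‖(↑w⁻¹ : 𝔄)‖ * ‖y - ↑u‖ * ‖(↑u⁻¹ : 𝔄)‖ := by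
      calc ‖(↑w⁻¹ : 𝔄)‖ = ‖↑u⁻¹ + ↑w⁻¹ * ((u : 𝔄) - ↑w) * ↑u⁻¹‖ := by rw [← key, add_sub_cancel]
        _ ≤ ‖(↑u⁻¹ : 𝔄)‖ + ‖(↑w⁻¹ : 𝔄) * ((u : 𝔄) - ↑w) * ↑u⁻¹‖ := norm_add_le _ _
        _ ≤ ‖(↑u⁻¹ : 𝔄)‖ + ‖(↑w⁻¹ : 𝔄)‖ * ‖y - ↑u‖ * ‖(↑u⁻¹ : 𝔄)‖ := add_le_add le_rfl hprod
    nlinarith [norm_nonneg (↑w⁻¹ : 𝔄), h, h1]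
  refine ⟨hunit, ?_, ?_⟩
  · rw [hinv]; exact hW
  · rw [hinv, key]
    calc ‖(↑w⁻¹ : 𝔄) * ((u : 𝔄) - ↑w) * ↑u⁻¹‖ ≤ ‖(↑w⁻¹ : 𝔄)‖ * ‖y - ↑u‖ * ‖(↑u⁻¹ : 𝔄)‖ := hprod
      _ ≤ 2 * ‖(↑u⁻¹ : 𝔄)‖ * ‖y - ↑u‖ * ‖(↑u⁻¹ : 𝔄)‖ := by gcongr
      _ = 2 * ‖(↑u⁻¹ : 𝔄)‖ ^ 2 * ‖y - ↑u‖ := by ring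

/-! ## §2  Ordered four-products and the plaquette variable about a configuration of units -/

omit [NormedAlgebra ℂ 𝔄] [CompleteSpace 𝔄] [NormOneClass 𝔄] in
/-- `‖abcd‖ ≤ ‖a‖‖b‖‖c‖‖d‖`. [textbook] -/
theorem norm_mul_four_le (a b c d : 𝔄) : ‖a * b * c * d‖ ≤ ‖a‖ * ‖b‖ * ‖c‖ * ‖d‖ :=
  (norm_mul_le _ _).trans (mul_le_mul_of_nonneg_right norm_mul₃_le (norm_nonneg _))

omit [NormedAlgebra ℂ 𝔄] [CompleteSpace 𝔄] [NormOneClass 𝔄] in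
/-- **PERTURBATION OF AN ORDERED FOUR-PRODUCT**: factors of norm `≤ m`, corresponding factors `L_i`-close ⇒
`‖a₁a₂a₃a₄ − b₁b₂b₃b₄‖ ≤ m³·(L₁ + L₂ + L₃ + L₄)` (telescoping; no commutativity). [textbook] -/
theorem norm_mul_four_sub_mul_four_le {a₁ a₂ a₃ a₄ b₁ b₂ b₃ b₄ : 𝔄} {m L₁ L₂ L₃ L₄ : ℝ} (hm : 0 ≤ m)
    (ha₂ : ‖a₂‖ ≤ m) (ha₃ : ‖a₃‖ ≤ m) (ha₄ : ‖a₄‖ ≤ m) (hb₁ : ‖b₁‖ ≤ m) (hb₂ : ‖b₂‖ ≤ m) (hb₃ : ‖b₃‖ ≤ m)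
    (h₁ : ‖a₁ - b₁‖ ≤ L₁) (h₂ : ‖a₂ - b₂‖ ≤ L₂) (h₃ : ‖a₃ - b₃‖ ≤ L₃) (h₄ : ‖a₄ - b₄‖ ≤ L₄) :
    ‖a₁ * a₂ * a₃ * a₄ - b₁ * b₂ * b₃ * b₄‖ ≤ m ^ 3 * (L₁ + L₂ + L₃ + L₄) := by
  rw [show a₁ * a₂ * a₃ * a₄ - b₁ * b₂ * b₃ * b₄ = (a₁ - b₁) * a₂ * a₃ * a₄ + b₁ * (a₂ - b₂) * a₃ * a₄ +
      b₁ * b₂ * (a₃ - b₃) * a₄ + b₁ * b₂ * b₃ * (a₄ - b₄) by noncomm_ring]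
  have hL₁ : 0 ≤ L₁ := (norm_nonneg _).trans h₁
  have hL₂ : 0 ≤ L₂ := (norm_nonneg _).trans h₂
  have hL₃ : 0 ≤ L₃ := (norm_nonneg _).trans h₃
  have t₁ : ‖(a₁ - b₁) * a₂ * a₃ * a₄‖ ≤ L₁ * m * m * m := (norm_mul_four_le _ _ _ _).trans (by gcongr)
  have t₂ : ‖b₁ * (a₂ - b₂) * a₃ * a₄‖ ≤ m * L₂ * m * m := (norm_mul_four_le _ _ _ _).trans (by gcongr)
  have t₃ : ‖b₁ * b₂ * (a₃ - b₃) * a₄‖ ≤ m * m * L₃ * m := (norm_mul_four_le _ _ _ _).trans (by gcongr)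
  have t₄ : ‖b₁ * b₂ * b₃ * (a₄ - b₄)‖ ≤ m * m * m * L₄ := (norm_mul_four_le _ _ _ _).trans (by gcongr)
  calc ‖(a₁ - b₁) * a₂ * a₃ * a₄ + b₁ * (a₂ - b₂) * a₃ * a₄ + b₁ * b₂ * (a₃ - b₃) * a₄ +
          b₁ * b₂ * b₃ * (a₄ - b₄)‖
      ≤ ‖(a₁ - b₁) * a₂ * a₃ * a₄‖ + ‖b₁ * (a₂ - b₂) * a₃ * a₄‖ + ‖b₁ * b₂ * (a₃ - b₃) * a₄‖ +
          ‖b₁ * b₂ * b₃ * (a₄ - b₄)‖ := norm_add₄_le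
    _ ≤ L₁ * m * m * m + m * L₂ * m * m + m * m * L₃ * m + m * m * m * L₄ := by gcongr
    _ = m ^ 3 * (L₁ + L₂ + L₃ + L₄) := by ring

omit [NormedAlgebra ℂ 𝔄] in
/-- **BOND LETTERS NEAR A CONFIGURATION OF UNITS.**  `V` a configuration of units with `‖V(b)‖ ≤ n`,
`‖V(b)⁻¹‖ ≤ n′`; `‖V′ − V‖ ≤ η` in the sup norm over bonds; `η·n′ ≤ ½`.  Then every bond variable of `V′` is a unit,
`‖V′(b)‖ ≤ n + η`, `‖V′(b)⁻¹‖ ≤ 2n′`, `‖V′(b) − V(b)‖ ≤ η`, `‖V′(b)⁻¹ − V(b)⁻¹‖ ≤ 2n′²·η`. [textbook] -/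
theorem bond_letters_of_near_units {B : Type*} [Fintype B] {V V' : B → 𝔄} {n n' η : ℝ}
    (hV : ∀ b, IsUnit (V b)) (hn : ∀ b, ‖V b‖ ≤ n) (hn' : ∀ b, ‖Ring.inverse (V b)‖ ≤ n')
    (hη : ‖V' - V‖ ≤ η) (hsmall : η * n' ≤ 1 / 2) (b : B) :
    IsUnit (V' b) ∧ ‖V' b‖ ≤ n + η ∧ ‖Ring.inverse (V' b)‖ ≤ 2 * n' ∧ ‖V' b - V b‖ ≤ η ∧
      ‖Ring.inverse (V' b) - Ring.inverse (V b)‖ ≤ 2 * n' ^ 2 * η := by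
  obtain ⟨u, hu⟩ := hV b
  have hb : ‖V' b - V b‖ ≤ η := (norm_le_pi_norm (V' - V) b).trans hη
  have hη0 : 0 ≤ η := (norm_nonneg _).trans hb
  have hu' : ‖(↑u⁻¹ : 𝔄)‖ ≤ n' := by
    have := hn' b; rwa [← hu, Ring.inverse_unit] at this
  have hn'0 : 0 ≤ n' := (norm_nonneg _).trans hu'
  have h : ‖V' b - ↑u‖ * ‖(↑u⁻¹ : 𝔄)‖ ≤ 1 / 2 := by
    rw [hu]
    calc ‖V' b - V b‖ * ‖(↑u⁻¹ : 𝔄)‖ ≤ η * n' := mul_le_mul hb hu' (norm_nonneg _) hη0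
      _ ≤ 1 / 2 := hsmall
  obtain ⟨hunit, hinv, hdiff⟩ := inverse_letters_of_norm_sub_le_half u h
  rw [hu] at hdiff
  have hVinv : Ring.inverse (V b) = ↑u⁻¹ := by rw [← hu, Ring.inverse_unit]
  rw [hVinv]
  refine ⟨hunit, ?_, hinv.trans (by gcongr), hb, hdiff.trans (by gcongr)⟩
  calc ‖V' b‖ = ‖V b + (V' b - V b)‖ := by rw [add_sub_cancel]
    _ ≤ ‖V b‖ + ‖V' b - V b‖ := norm_add_le _ _
    _ ≤ n + η := add_le_add (hn b) hb

omit [NormedAlgebra ℂ 𝔄] in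
/-- ★ **THE PLAQUETTE VARIABLE IS LIPSCHITZ IN THE BOND-SUP NORM ABOUT A CONFIGURATION OF UNITS** (the `Gᶜ`-valued
twin of `B9Ineq369CurvatureTwoBackgrounds.norm_plaqHolU_sub_le`): with the bond letters of
`bond_letters_of_near_units`, for every oriented plaquette `p = (b₁, b₂, b₃, b₄)` (last two bonds backward)
`‖∂V′(p) − ∂V(p)‖ ≤ max(n + η, 2n′)³·(2 + 4n′²)·η`. [textbook] -/
theorem plaqReading_sub_le_of_units {B : Type*} [Fintype B] {V V' : B → 𝔄} {n n' η : ℝ}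
    (hV : ∀ b, IsUnit (V b)) (hn : ∀ b, ‖V b‖ ≤ n) (hn' : ∀ b, ‖Ring.inverse (V b)‖ ≤ n')
    (hη : ‖V' - V‖ ≤ η) (hsmall : η * n' ≤ 1 / 2) (p : B × B × B × B) :
    ‖V' p.1 * V' p.2.1 * Ring.inverse (V' p.2.2.1) * Ring.inverse (V' p.2.2.2) -
        V p.1 * V p.2.1 * Ring.inverse (V p.2.2.1) * Ring.inverse (V p.2.2.2)‖
      ≤ max (n + η) (2 * n') ^ 3 * (2 + 4 * n' ^ 2) * η := by
  have L := fun b => bond_letters_of_near_units hV hn hn' hη hsmall b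
  have hη0 : 0 ≤ η := (norm_nonneg _).trans hη
  obtain ⟨b₀⟩ : Nonempty B := ⟨p.1⟩
  have hn'0 : 0 ≤ n' := (norm_nonneg _).trans (hn' b₀)
  set m := max (n + η) (2 * n') with hm_def
  have hm0 : 0 ≤ m := le_max_of_le_right (by positivity)
  have hVm : ∀ b, ‖V b‖ ≤ m := fun b => ((hn b).trans (le_add_of_nonneg_right hη0)).trans (le_max_left _ _)
  have hV'm : ∀ b, ‖V' b‖ ≤ m := fun b => (L b).2.1.trans (le_max_left _ _)
  have hIm : ∀ b, ‖Ring.inverse (V b)‖ ≤ m := fun b =>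
    ((hn' b).trans (by linarith [hn'0])).trans (le_max_right _ _)
  have hI'm : ∀ b, ‖Ring.inverse (V' b)‖ ≤ m := fun b => (L b).2.2.1.trans (le_max_right _ _)
  calc ‖V' p.1 * V' p.2.1 * Ring.inverse (V' p.2.2.1) * Ring.inverse (V' p.2.2.2) -
          V p.1 * V p.2.1 * Ring.inverse (V p.2.2.1) * Ring.inverse (V p.2.2.2)‖
      ≤ m ^ 3 * (η + η + 2 * n' ^ 2 * η + 2 * n' ^ 2 * η) :=
        norm_mul_four_sub_mul_four_le hm0 (hV'm _) (hI'm _) (hI'm _) (hVm _) (hVm _) (hIm _)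
          (L p.1).2.2.2.1 (L p.2.1).2.2.2.1 (L p.2.2.1).2.2.2.2 (L p.2.2.2).2.2.2.2
    _ = max (n + η) (2 * n') ^ 3 * (2 + 4 * n' ^ 2) * η := by rw [hm_def]; ring

/-! ## §3  The values of the exponential block chart are units: norms of the bond variables and their inverses -/

omit [NormOneClass 𝔄] in
/-- `exp A` is a unit in a complete normed `ℂ`-algebra (Mathlib's `isUnit_exp` read over `𝕂 = ℂ`: the exponential
series has infinite radius). [textbook] -/
theorem isUnit_exp_complex (A : 𝔄) : IsUnit (exp A) :=
  isUnit_exp_of_mem_ball (𝕂 := ℂ) ((expSeries_radius_eq_top ℂ 𝔄).symm ▸ edist_lt_top _ _)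

omit [NormOneClass 𝔄] in
/-- `(exp A)⁻¹ = exp (−A)` for the honest inverse `Ring.inverse`, in a complete normed `ℂ`-algebra. [textbook] -/
theorem inverse_exp_complex (A : 𝔄) : Ring.inverse (exp A) = exp (-A) := by
  have hA : A ∈ Metric.eball (0 : 𝔄) (expSeries ℂ 𝔄).radius :=
    (expSeries_radius_eq_top ℂ 𝔄).symm ▸ edist_lt_top _ _
  letI := invertibleExpOfMemBall (𝕂 := ℂ) hA
  rw [Ring.inverse_invertible, invOf_exp_of_mem_ball hA]

variable {κ B : Type*} [Fintype κ] [Fintype B]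

omit [NormOneClass 𝔄] [Fintype B] in
/-- every bond variable `exp(Σ_a w_a•X_a(b))·V₀(b)` of the chart is a unit (`exp` of anything is a unit; `V₀(b)` is).
[textbook] -/
theorem isUnit_blockExpChart_apply (X : κ → B → 𝔄) (V₀ : B → 𝔄ˣ) (w : κ → ℂ) (b : B) :
    IsUnit (exp (∑ a, w a • X a b) * (V₀ b : 𝔄)) :=
  (isUnit_exp_complex _).mul (V₀ b).isUnit

omit [NormOneClass 𝔄] [Fintype B] in
/-- the reversed bond variable of the chart: `(exp(A)·V₀(b))⁻¹ = V₀(b)⁻¹·exp(−A)` ([B9] (3.5) `U(x, x′) = U⁻¹(x′, x)`).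
[textbook] -/
theorem inverse_blockExpChart_apply (X : κ → B → 𝔄) (V₀ : B → 𝔄ˣ) (w : κ → ℂ) (b : B) :
    Ring.inverse (exp (∑ a, w a • X a b) * (V₀ b : 𝔄)) = ↑(V₀ b)⁻¹ * exp (-∑ a, w a • X a b) := by
  rw [Ring.inverse_mul (Or.inl (isUnit_exp_complex _)), Ring.inverse_unit, inverse_exp_complex]

omit [Fintype B] in
/-- `‖exp(Σ_a x_a•X_a(b))·V₀(b)‖ ≤ e^{‖x‖Ξ}·v` for `Σ_a ‖X_a(b)‖ ≤ Ξ`, `‖V₀(b)‖ ≤ v`. [textbook] -/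
theorem norm_blockExpChart_apply_le (X : κ → B → 𝔄) (V₀ : B → 𝔄ˣ) {Ξ v : ℝ} (hΞ : ∀ b, ∑ a, ‖X a b‖ ≤ Ξ)
    (hv : ∀ b, ‖(V₀ b : 𝔄)‖ ≤ v) (x : κ → ℂ) (b : B) :
    ‖exp (∑ a, x a • X a b) * (V₀ b : 𝔄)‖ ≤ Real.exp (‖x‖ * Ξ) * v := by
  have hv0 : 0 ≤ v := (norm_nonneg _).trans (hv b)
  calc ‖exp (∑ a, x a • X a b) * (V₀ b : 𝔄)‖ ≤ ‖exp (∑ a, x a • X a b)‖ * ‖(V₀ b : 𝔄)‖ := norm_mul_le _ _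
    _ ≤ Real.exp ‖∑ a, x a • X a b‖ * v :=
        mul_le_mul (Literature.Analysis.Complex.norm_exp_le_exp_norm _) (hv b) (norm_nonneg _) (by positivity)
    _ ≤ Real.exp (‖x‖ * Ξ) * v :=
        mul_le_mul_of_nonneg_right (Real.exp_le_exp.2 (norm_blockExponent_le X hΞ x b)) hv0

omit [Fintype B] in
/-- `‖(exp(Σ_a x_a•X_a(b))·V₀(b))⁻¹‖ ≤ v′·e^{‖x‖Ξ}` for `Σ_a ‖X_a(b)‖ ≤ Ξ`, `‖V₀(b)⁻¹‖ ≤ v′`. [textbook] -/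
theorem norm_inverse_blockExpChart_apply_le (X : κ → B → 𝔄) (V₀ : B → 𝔄ˣ) {Ξ v' : ℝ}
    (hΞ : ∀ b, ∑ a, ‖X a b‖ ≤ Ξ) (hv' : ∀ b, ‖(↑(V₀ b)⁻¹ : 𝔄)‖ ≤ v') (x : κ → ℂ) (b : B) :
    ‖Ring.inverse (exp (∑ a, x a • X a b) * (V₀ b : 𝔄))‖ ≤ v' * Real.exp (‖x‖ * Ξ) := by
  have hv0 : 0 ≤ v' := (norm_nonneg _).trans (hv' b)
  rw [inverse_blockExpChart_apply]
  calc ‖(↑(V₀ b)⁻¹ : 𝔄) * exp (-∑ a, x a • X a b)‖ ≤ ‖(↑(V₀ b)⁻¹ : 𝔄)‖ * ‖exp (-∑ a, x a • X a b)‖ :=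
        norm_mul_le _ _
    _ ≤ v' * Real.exp ‖-∑ a, x a • X a b‖ :=
        mul_le_mul (hv' b) (Literature.Analysis.Complex.norm_exp_le_exp_norm _) (norm_nonneg _) hv0
    _ ≤ v' * Real.exp (‖x‖ * Ξ) := by
        rw [norm_neg]
        exact mul_le_mul_of_nonneg_left (Real.exp_le_exp.2 (norm_blockExponent_le X hΞ x b)) hv0

/-! ## §4  The field-strength letter `c_B`: the bond-sup ball about `χ(x)` lies in the regular set -/

/-- ★ **THE FIELD-STRENGTH LETTER OF THE EXPONENTIAL BLOCK CHART.**  If the base configuration `χ(x)` is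
`δ`-regular on the block's plaquettes (`‖∂χ(x)(p) − 1‖ ≤ δ` for `p ∈ plaqs`) and `R·v′e^{‖x‖Ξ} ≤ ½`, then every
configuration `V` of the closed bond-sup ball of radius `R` about `χ(x)` has unit bond variables and is
`(δ + c·R)`-regular on `plaqs`, `c = max(e^{‖x‖Ξ}v + R, 2v′e^{‖x‖Ξ})³·(2 + 4(v′e^{‖x‖Ξ})²)` — the located
conversion constant `c_B` of file 4's (L2), a FORMULA in the chart data (with file 5: `R = ℓr`). [textbook] -/
theorem fieldStrength_closedBall_blockExpChart (X : κ → B → 𝔄) (V₀ : B → 𝔄ˣ) {Ξ v v' R δ : ℝ}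
    (hΞ : ∀ b, ∑ a, ‖X a b‖ ≤ Ξ) (hv : ∀ b, ‖(V₀ b : 𝔄)‖ ≤ v) (hv' : ∀ b, ‖(↑(V₀ b)⁻¹ : 𝔄)‖ ≤ v')
    (x : κ → ℂ) (hR : R * (v' * Real.exp (‖x‖ * Ξ)) ≤ 1 / 2) (plaqs : Finset (B × B × B × B))
    (hδ : ∀ p ∈ plaqs, ‖exp (∑ a, x a • X a p.1) * (V₀ p.1 : 𝔄) * (exp (∑ a, x a • X a p.2.1) * (V₀ p.2.1 : 𝔄)) *
        Ring.inverse (exp (∑ a, x a • X a p.2.2.1) * (V₀ p.2.2.1 : 𝔄)) *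
        Ring.inverse (exp (∑ a, x a • X a p.2.2.2) * (V₀ p.2.2.2 : 𝔄)) - 1‖ ≤ δ) :
    ∀ V ∈ closedBall (fun b => exp (∑ a, x a • X a b) * (V₀ b : 𝔄)) R,
      (∀ b, IsUnit (V b)) ∧ ∀ p ∈ plaqs,
        ‖V p.1 * V p.2.1 * Ring.inverse (V p.2.2.1) * Ring.inverse (V p.2.2.2) - 1‖ ≤
          δ + max (Real.exp (‖x‖ * Ξ) * v + R) (2 * (v' * Real.exp (‖x‖ * Ξ))) ^ 3 *
            (2 + 4 * (v' * Real.exp (‖x‖ * Ξ)) ^ 2) * R := by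
  intro V hV
  rw [mem_closedBall, dist_eq_norm] at hV
  have hU : ∀ b, IsUnit ((fun b => exp (∑ a, x a • X a b) * (V₀ b : 𝔄)) b) := fun b =>
    isUnit_blockExpChart_apply X V₀ x b
  have hn : ∀ b, ‖(fun b => exp (∑ a, x a • X a b) * (V₀ b : 𝔄)) b‖ ≤ Real.exp (‖x‖ * Ξ) * v := fun b =>
    norm_blockExpChart_apply_le X V₀ hΞ hv x b
  have hn' : ∀ b, ‖Ring.inverse ((fun b => exp (∑ a, x a • X a b) * (V₀ b : 𝔄)) b)‖ ≤
      v' * Real.exp (‖x‖ * Ξ) := fun b => norm_inverse_blockExpChart_apply_le X V₀ hΞ hv' x b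
  refine ⟨fun b => (bond_letters_of_near_units hU hn hn' hV hR b).1, fun p hp => ?_⟩
  have hL := plaqReading_sub_le_of_units hU hn hn' hV hR p
  have hb := hδ p hp
  calc ‖V p.1 * V p.2.1 * Ring.inverse (V p.2.2.1) * Ring.inverse (V p.2.2.2) - 1‖
      = ‖(V p.1 * V p.2.1 * Ring.inverse (V p.2.2.1) * Ring.inverse (V p.2.2.2) -
          exp (∑ a, x a • X a p.1) * (V₀ p.1 : 𝔄) * (exp (∑ a, x a • X a p.2.1) * (V₀ p.2.1 : 𝔄)) *
            Ring.inverse (exp (∑ a, x a • X a p.2.2.1) * (V₀ p.2.2.1 : 𝔄)) *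
            Ring.inverse (exp (∑ a, x a • X a p.2.2.2) * (V₀ p.2.2.2 : 𝔄))) +
          (exp (∑ a, x a • X a p.1) * (V₀ p.1 : 𝔄) * (exp (∑ a, x a • X a p.2.1) * (V₀ p.2.1 : 𝔄)) *
            Ring.inverse (exp (∑ a, x a • X a p.2.2.1) * (V₀ p.2.2.1 : 𝔄)) *
            Ring.inverse (exp (∑ a, x a • X a p.2.2.2) * (V₀ p.2.2.2 : 𝔄)) - 1)‖ := by rw [sub_add_sub_cancel]
    _ ≤ max (Real.exp (‖x‖ * Ξ) * v + R) (2 * (v' * Real.exp (‖x‖ * Ξ))) ^ 3 *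
            (2 + 4 * (v' * Real.exp (‖x‖ * Ξ)) ^ 2) * R + δ := (norm_add_le _ _).trans (add_le_add hL hb)
    _ = _ := by ring

/-! ## §5  The regular set of configurations is open; plaquette variables are complex differentiable on units -/

omit [NormedAlgebra ℂ 𝔄] [NormOneClass 𝔄] [Fintype κ] in
/-- the configurations with every bond variable a unit form an OPEN set (units are open in a complete normed ring;
finitely many bonds). [textbook] -/
theorem isOpen_unitConfigs : IsOpen {V : B → 𝔄 | ∀ b, IsUnit (V b)} := by
  have h : {V : B → 𝔄 | ∀ b, IsUnit (V b)} = ⋂ b, (fun V : B → 𝔄 => V b) ⁻¹' {y : 𝔄 | IsUnit y} := by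
    ext V; simp
  rw [h]
  exact isOpen_iInter_of_finite fun b => Units.isOpen.preimage (continuous_apply b)

omit [NormOneClass 𝔄] [Fintype κ] in
/-- **THE PLAQUETTE VARIABLE IS COMPLEX DIFFERENTIABLE ON THE UNIT CONFIGURATIONS** (`Ring.inverse` is
differentiable at units — Mathlib `differentiableAt_inverse`; evaluations are linear): plaquette readings of
differentiable maps of the configuration compose on the regular set. [textbook] -/
theorem differentiableOn_plaqReading (p : B × B × B × B) :
    DifferentiableOn ℂ (fun V : B → 𝔄 => V p.1 * V p.2.1 * Ring.inverse (V p.2.2.1) * Ring.inverse (V p.2.2.2))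
      {V : B → 𝔄 | ∀ b, IsUnit (V b)} := by
  intro V hV
  have hev : ∀ b, DifferentiableAt ℂ (fun V : B → 𝔄 => V b) V := fun b => differentiableAt_apply b V
  have hinv : ∀ b, DifferentiableAt ℂ (Ring.inverse ∘ fun V : B → 𝔄 => V b) V := fun b =>
    (differentiableAt_inverse (𝕜 := ℂ) (hV b)).comp V (hev b)
  exact (((hev p.1).mul (hev p.2.1)).mul (hinv p.2.2.1)).mul (hinv p.2.2.2) |>.differentiableWithinAt

omit [NormOneClass 𝔄] [Fintype κ] in
/-- **THE REGULAR SET IS OPEN**: `{V | (∀ b, IsUnit (V b)) ∧ ∀ p ∈ plaqs, ‖∂V(p) − 1‖ < ε}` is open in the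
bond-sup norm — so «`Ψ` differentiable on the regular set» is an honest analyticity clause (the SHAPE of the
complex regular spaces `B12RegularSpaces111.space`, (1.11)–(1.14) p. 262, cut out by plaquette variables of
`Gᶜ`-valued bond variables). [textbook] -/
theorem isOpen_regularConfigs (plaqs : Finset (B × B × B × B)) (ε : ℝ) :
    IsOpen {V : B → 𝔄 | (∀ b, IsUnit (V b)) ∧ ∀ p ∈ plaqs,
      ‖V p.1 * V p.2.1 * Ring.inverse (V p.2.2.1) * Ring.inverse (V p.2.2.2) - 1‖ < ε} := by
  have h : {V : B → 𝔄 | (∀ b, IsUnit (V b)) ∧ ∀ p ∈ plaqs,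
      ‖V p.1 * V p.2.1 * Ring.inverse (V p.2.2.1) * Ring.inverse (V p.2.2.2) - 1‖ < ε} =
      {V : B → 𝔄 | ∀ b, IsUnit (V b)} ∩ ⋂ p ∈ plaqs, ({V : B → 𝔄 | ∀ b, IsUnit (V b)} ∩
        (fun V : B → 𝔄 => V p.1 * V p.2.1 * Ring.inverse (V p.2.2.1) * Ring.inverse (V p.2.2.2)) ⁻¹'
          ball (1 : 𝔄) ε) := by
    ext V
    simp only [mem_setOf_eq, mem_inter_iff, mem_iInter, mem_preimage, mem_ball, dist_eq_norm]
    constructor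
    · rintro ⟨hU, hP⟩; exact ⟨hU, fun p hp => ⟨hU, hP p hp⟩⟩
    · rintro ⟨hU, hP⟩; exact ⟨hU, fun p hp => (hP p hp).2⟩
  rw [h]
  refine isOpen_unitConfigs.inter (isOpen_biInter_finset fun p _ => ?_)
  exact (differentiableOn_plaqReading p).continuousOn.isOpen_inter_preimage isOpen_unitConfigs isOpen_ball

/-! ## §6  File 5's response letters, knit at the regular set -/

/-- ★★ **RESPONSE LETTERS THROUGH THE EXPONENTIAL CHART, AT THE REGULAR SET** (file 5's
`responseLetters_of_blockExpChart` with its domain inclusion `hD` DISCHARGED by §4): if the plaquette reading `Ψ` of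
the minimiser is complex differentiable on the regular set of radius `ε` on `plaqs` with `‖Ψ‖ ≤ S` there (the
[B11] Theorem 1 ∕ [RG1] Lemma 4 SHAPE — NODE O's located input), the base configuration `χ(x)` is `δ`-regular on
`plaqs`, `ℓ = Ξe^{(‖x‖+r)Ξ}v` (file 5), `ℓr·v′e^{‖x‖Ξ} ≤ ½`, and the FIELD-STRENGTH BUDGET `δ + c·ℓr < ε` holds
(`c` of §4 at `R = ℓr`), then the response `Φ = Ψ ∘ χ` is complex differentiable on `ball x r` and maps it into
`closedBall (Φ x) (2S)` — file 2's letters `hd`, `hB` (`B = 2S`). [textbook] -/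
theorem responseLetters_of_blockExpChart_regular {E : Type*} [NormedAddCommGroup E] [NormedSpace ℂ E]
    (X : κ → B → 𝔄) (V₀ : B → 𝔄ˣ) {Ξ v v' r S δ ε : ℝ} (hΞ0 : 0 ≤ Ξ) (hΞ : ∀ b, ∑ a, ‖X a b‖ ≤ Ξ)
    (hv0 : 0 ≤ v) (hv : ∀ b, ‖(V₀ b : 𝔄)‖ ≤ v) (hv' : ∀ b, ‖(↑(V₀ b)⁻¹ : 𝔄)‖ ≤ v') (hr : 0 < r) (x : κ → ℂ)
    (hsmall : Ξ * Real.exp ((‖x‖ + r) * Ξ) * v * r * (v' * Real.exp (‖x‖ * Ξ)) ≤ 1 / 2)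
    (plaqs : Finset (B × B × B × B))
    (hδ : ∀ p ∈ plaqs, ‖exp (∑ a, x a • X a p.1) * (V₀ p.1 : 𝔄) * (exp (∑ a, x a • X a p.2.1) * (V₀ p.2.1 : 𝔄)) *
        Ring.inverse (exp (∑ a, x a • X a p.2.2.1) * (V₀ p.2.2.1 : 𝔄)) *
        Ring.inverse (exp (∑ a, x a • X a p.2.2.2) * (V₀ p.2.2.2 : 𝔄)) - 1‖ ≤ δ)
    (hbudget : δ + max (Real.exp (‖x‖ * Ξ) * v + Ξ * Real.exp ((‖x‖ + r) * Ξ) * v * r)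
        (2 * (v' * Real.exp (‖x‖ * Ξ))) ^ 3 * (2 + 4 * (v' * Real.exp (‖x‖ * Ξ)) ^ 2) *
        (Ξ * Real.exp ((‖x‖ + r) * Ξ) * v * r) < ε)
    (Ψ : (B → 𝔄) → E)
    (hΨd : DifferentiableOn ℂ Ψ {V : B → 𝔄 | (∀ b, IsUnit (V b)) ∧ ∀ p ∈ plaqs,
      ‖V p.1 * V p.2.1 * Ring.inverse (V p.2.2.1) * Ring.inverse (V p.2.2.2) - 1‖ < ε})
    (hΨS : ∀ V ∈ {V : B → 𝔄 | (∀ b, IsUnit (V b)) ∧ ∀ p ∈ plaqs,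
      ‖V p.1 * V p.2.1 * Ring.inverse (V p.2.2.1) * Ring.inverse (V p.2.2.2) - 1‖ < ε}, ‖Ψ V‖ ≤ S) :
    DifferentiableOn ℂ (Ψ ∘ fun w : κ → ℂ => fun b => exp (∑ a, w a • X a b) * (V₀ b : 𝔄)) (ball x r) ∧
      MapsTo (Ψ ∘ fun w : κ → ℂ => fun b => exp (∑ a, w a • X a b) * (V₀ b : 𝔄)) (ball x r)
        (closedBall ((Ψ ∘ fun w : κ → ℂ => fun b => exp (∑ a, w a • X a b) * (V₀ b : 𝔄)) x) (2 * S)) := by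
  refine responseLetters_of_blockExpChart X (fun b => (V₀ b : 𝔄)) hΞ0 hΞ hv0 hv hr x Ψ ?_ hΨd hΨS
  intro V hV
  obtain ⟨hU, hP⟩ := fieldStrength_closedBall_blockExpChart X V₀ hΞ hv hv' x hsmall plaqs hδ V hV
  exact ⟨hU, fun p hp => (hP p hp).trans_lt hbudget⟩

/-! ## §7  A2∕A6: the letters of §4 are inhabited (`𝔄 = ℂ`, one bond, one coordinate) -/

/-- **A2∕A6 — THE HYPOTHESES OF §4 ARE JOINTLY INHABITED AND ITS CONCLUSION IS READ AT A POINT `V ≠ χ(x)`**: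
`𝔄 = ℂ`, `κ = B = Unit`, `X = 1`, `V₀ = 1`, `x = 0` (so `χ(0) = 1`, field strength `0`: `δ = 0`), `Ξ = v = v′ = 1`,
`R = ½` (`R·v′e^{0} = ½`), the one plaquette `((),(),(),())`; the constant configuration `V = 5∕4` lies in the
closed ball, so §4 certifies its bond variable a unit and bounds its field strength by `0 + c·½`. [textbook] -/
theorem fieldStrength_letters_inhabited :
    IsUnit ((fun _ : Unit => (5 / 4 : ℂ)) ()) ∧
      ∀ p ∈ (Finset.univ : Finset (Unit × Unit × Unit × Unit)),
        ‖(fun _ : Unit => (5 / 4 : ℂ)) p.1 * (fun _ : Unit => (5 / 4 : ℂ)) p.2.1 *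
            Ring.inverse ((fun _ : Unit => (5 / 4 : ℂ)) p.2.2.1) * Ring.inverse ((fun _ : Unit => (5 / 4 : ℂ)) p.2.2.2)
            - 1‖ ≤
          0 + max (Real.exp (‖(0 : Unit → ℂ)‖ * 1) * 1 + 1 / 2) (2 * (1 * Real.exp (‖(0 : Unit → ℂ)‖ * 1))) ^ 3 *
            (2 + 4 * (1 * Real.exp (‖(0 : Unit → ℂ)‖ * 1)) ^ 2) * (1 / 2) := by
  have h := fieldStrength_closedBall_blockExpChart (𝔄 := ℂ) (κ := Unit) (B := Unit) (fun _ _ => (1 : ℂ))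
    (fun _ => (1 : ℂˣ)) (Ξ := 1) (v := 1) (v' := 1) (R := 1 / 2) (δ := 0) (fun _ => by simp) (fun _ => by simp)
    (fun _ => by simp) 0 (by simp) Finset.univ (fun p _ => by simp) (fun _ => (5 / 4 : ℂ)) ?_
  · exact ⟨h.1 (), h.2⟩
  · rw [mem_closedBall, dist_eq_norm]
    refine (pi_norm_le_iff_of_nonneg (by norm_num)).2 fun _ => ?_
    simp only [Pi.sub_apply, Pi.zero_apply, zero_smul, Finset.sum_const_zero, NormedSpace.exp_zero,
      Units.val_one, mul_one]
    norm_num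

end Summit.QuantumFields.YangMills.Theorems.N21ExponentialChartFieldStrength
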